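import Summits.Ventures.HodgeRepro.Night3CensusS4
import Summits.Ventures.HodgeRepro.Night3CensusCover8
import Summits.Ventures.HodgeRepro.Night3CensusCover12a
import Summits.Ventures.HodgeRepro.Night3CensusCover12b

/-!
# «S4 on the sealed census representatives ⟹ S4» for the eleven sealed rows (kernel)

Blind re-derivation cell `pub-hodge-repro`, seat `night-3` (gen 3).  Imports night-3's generic `alg_of_reps`
(`Night3CensusS4`) and the cover theorems of the eleven sealed census rows (`Night3CensusCover8` /
`Night3CensusCover12a` / `Night3CensusCover12b`: every face of the row's `(G, c)` is a Galois twist of a sealed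
representative).  Namespace `HodgeRepro.Night3.Census`.

The eleven instances `alg_of_reps_<row>` read: for the Galois CM type `(Elt Γ, conj Γ)` of a sealed row, a predicate
`Alg` on multisets of CM types with `hadd` / `hcancel` (Lemma P), `hpair` (Lefschetz (1,1) on the conjugate pairs),
`htwist` (Galois twists preserve `Alg`) and `hreps` — `Alg` on the corner multisets of the row's sealed representatives
`reps` (1 / 3, 4, 4, 6, 5, 3 / 20, 22, 26, 20 of them) — holds on every zero-sum multiset: S4 on the sealed
representatives ⟹ S4 for every corner product of that Galois CM field.  The open input is exactly the census as
ROUTE.md §3 counts it; `alg_of_sexticFace` spells out degree 6 (ONE face).  Nothing here closes S4; no sealed file is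
touched; no Tier-2 item depends on this file.
-/

set_option autoImplicit false

namespace HodgeRepro.Night3.Census

open Summit.Ventures.HodgeRepro.FaceCensus
open HodgeRepro.EngineBridge
open HodgeRepro.Night3.GSet
open scoped Pointwise

/-- The zero-sum condition `IsZeroSumG` is decidable on a finite group (unfolding to finite conjunctions). -/
instance decIsZeroSumG {G : Type*} [Group G] [DecidableEq G] [Fintype G] (c : G) (M : Multiset (Finset G)) :
    Decidable (IsZeroSumG c M) := by
  unfold IsZeroSumG IsCMMultiset
  infer_instance

/-! ### Sanity: the sealed representatives' corner multisets are zero-sum (the hypotheses of `hreps` are about genuine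
(eq2)-corner products, read in the model) — decided for the seven rows of degree 6 and 8 (the degree-12 lists exceed the
default kernel budget in this form; their faces are `sumTwo` by the sealed census itself) -/

/-- Row `Sextic.Cyclic`: every sealed representative's corner multiset is zero-sum in the model. -/
theorem isZeroSumG_reps_sexticCyclic :
    ∀ r ∈ Sextic.Cyclic.reps, IsZeroSumG (Elt.conj Sextic.Cyclic.Γ) (cornersMul Sextic.Cyclic.Γ r) := by
  decide +kernel

/-- Row `Octic.Cyclic`: every sealed representative's corner multiset is zero-sum in the model. -/
theorem isZeroSumG_reps_octicCyclic :
    ∀ r ∈ Octic.Cyclic.reps, IsZeroSumG (Elt.conj Octic.Cyclic.Γ) (cornersMul Octic.Cyclic.Γ r) := by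
  decide +kernel

/-- Row `Octic.C4C2Square`: every sealed representative's corner multiset is zero-sum in the model. -/
theorem isZeroSumG_reps_octicC4C2Square :
    ∀ r ∈ Octic.C4C2Square.reps, IsZeroSumG (Elt.conj Octic.C4C2Square.Γ) (cornersMul Octic.C4C2Square.Γ r) := by
  decide +kernel

/-- Row `Octic.C4C2Nonsquare`: every sealed representative's corner multiset is zero-sum in the model. -/
theorem isZeroSumG_reps_octicC4C2Nonsquare :
    ∀ r ∈ Octic.C4C2Nonsquare.reps, IsZeroSumG (Elt.conj Octic.C4C2Nonsquare.Γ) (cornersMul Octic.C4C2Nonsquare.Γ r) := by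
  decide +kernel

/-- Row `Octic.Triquadratic`: every sealed representative's corner multiset is zero-sum in the model. -/
theorem isZeroSumG_reps_octicTriquadratic :
    ∀ r ∈ Octic.Triquadratic.reps, IsZeroSumG (Elt.conj Octic.Triquadratic.Γ) (cornersMul Octic.Triquadratic.Γ r) := by
  decide +kernel

/-- Row `Octic.Dihedral`: every sealed representative's corner multiset is zero-sum in the model. -/
theorem isZeroSumG_reps_octicDihedral :
    ∀ r ∈ Octic.Dihedral.reps, IsZeroSumG (Elt.conj Octic.Dihedral.Γ) (cornersMul Octic.Dihedral.Γ r) := by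
  decide +kernel

/-- Row `Octic.Quaternion`: every sealed representative's corner multiset is zero-sum in the model. -/
theorem isZeroSumG_reps_octicQuaternion :
    ∀ r ∈ Octic.Quaternion.reps, IsZeroSumG (Elt.conj Octic.Quaternion.Γ) (cornersMul Octic.Quaternion.Γ r) := by
  decide +kernel

/-- **Row `Sextic.Cyclic`** (degree 6, cyclic; 1 representative): S4 on the sealed representatives' corner products ⟹ S4 for every corner product. -/
theorem alg_of_reps_sexticCyclic (Alg : Multiset (Finset (Elt Sextic.Cyclic.Γ)) → Prop)
    (hadd : ∀ M N, IsZeroSumG (Elt.conj Sextic.Cyclic.Γ) M → IsZeroSumG (Elt.conj Sextic.Cyclic.Γ) N → Alg M → Alg N → Alg (M + N))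
    (hcancel : ∀ M N, IsZeroSumG (Elt.conj Sextic.Cyclic.Γ) M → IsZeroSumG (Elt.conj Sextic.Cyclic.Γ) N → Alg (M + N) → Alg N → Alg M)
    (hpair : ∀ Φ, IsCMType (Elt.conj Sextic.Cyclic.Γ) Φ → Alg {Φ, Elt.conj Sextic.Cyclic.Γ • Φ})
    (htwist : ∀ M g, Alg M → Alg (twistMul M g))
    (hreps : ∀ r ∈ Sextic.Cyclic.reps, Alg (cornersMul Sextic.Cyclic.Γ r))
    (M : Multiset (Finset (Elt Sextic.Cyclic.Γ))) (hM : IsZeroSumG (Elt.conj Sextic.Cyclic.Γ) M) : Alg M :=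
  alg_of_reps Sextic.Cyclic.Γ Sextic.Cyclic.reps coversFaces_sexticCyclic Alg hadd hcancel hpair htwist hreps M hM

/-- **Row `Octic.Cyclic`** (degree 8, cyclic; 3): S4 on the sealed representatives' corner products ⟹ S4 for every corner product. -/
theorem alg_of_reps_octicCyclic (Alg : Multiset (Finset (Elt Octic.Cyclic.Γ)) → Prop)
    (hadd : ∀ M N, IsZeroSumG (Elt.conj Octic.Cyclic.Γ) M → IsZeroSumG (Elt.conj Octic.Cyclic.Γ) N → Alg M → Alg N → Alg (M + N))
    (hcancel : ∀ M N, IsZeroSumG (Elt.conj Octic.Cyclic.Γ) M → IsZeroSumG (Elt.conj Octic.Cyclic.Γ) N → Alg (M + N) → Alg N → Alg M)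
    (hpair : ∀ Φ, IsCMType (Elt.conj Octic.Cyclic.Γ) Φ → Alg {Φ, Elt.conj Octic.Cyclic.Γ • Φ})
    (htwist : ∀ M g, Alg M → Alg (twistMul M g))
    (hreps : ∀ r ∈ Octic.Cyclic.reps, Alg (cornersMul Octic.Cyclic.Γ r))
    (M : Multiset (Finset (Elt Octic.Cyclic.Γ))) (hM : IsZeroSumG (Elt.conj Octic.Cyclic.Γ) M) : Alg M :=
  alg_of_reps Octic.Cyclic.Γ Octic.Cyclic.reps coversFaces_octicCyclic Alg hadd hcancel hpair htwist hreps M hM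

/-- **Row `Octic.C4C2Square`** (degree 8, `ℤ/4 × ℤ/2`, `c` a square; 4): S4 on the sealed representatives' corner products ⟹ S4 for every corner product. -/
theorem alg_of_reps_octicC4C2Square (Alg : Multiset (Finset (Elt Octic.C4C2Square.Γ)) → Prop)
    (hadd : ∀ M N, IsZeroSumG (Elt.conj Octic.C4C2Square.Γ) M → IsZeroSumG (Elt.conj Octic.C4C2Square.Γ) N → Alg M → Alg N → Alg (M + N))
    (hcancel : ∀ M N, IsZeroSumG (Elt.conj Octic.C4C2Square.Γ) M → IsZeroSumG (Elt.conj Octic.C4C2Square.Γ) N → Alg (M + N) → Alg N → Alg M)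
    (hpair : ∀ Φ, IsCMType (Elt.conj Octic.C4C2Square.Γ) Φ → Alg {Φ, Elt.conj Octic.C4C2Square.Γ • Φ})
    (htwist : ∀ M g, Alg M → Alg (twistMul M g))
    (hreps : ∀ r ∈ Octic.C4C2Square.reps, Alg (cornersMul Octic.C4C2Square.Γ r))
    (M : Multiset (Finset (Elt Octic.C4C2Square.Γ))) (hM : IsZeroSumG (Elt.conj Octic.C4C2Square.Γ) M) : Alg M :=
  alg_of_reps Octic.C4C2Square.Γ Octic.C4C2Square.reps coversFaces_octicC4C2Square Alg hadd hcancel hpair htwist hreps M hM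

/-- **Row `Octic.C4C2Nonsquare`** (degree 8, `ℤ/4 × ℤ/2`, `c` a non-square; 4): S4 on the sealed representatives' corner products ⟹ S4 for every corner product. -/
theorem alg_of_reps_octicC4C2Nonsquare (Alg : Multiset (Finset (Elt Octic.C4C2Nonsquare.Γ)) → Prop)
    (hadd : ∀ M N, IsZeroSumG (Elt.conj Octic.C4C2Nonsquare.Γ) M → IsZeroSumG (Elt.conj Octic.C4C2Nonsquare.Γ) N → Alg M → Alg N → Alg (M + N))
    (hcancel : ∀ M N, IsZeroSumG (Elt.conj Octic.C4C2Nonsquare.Γ) M → IsZeroSumG (Elt.conj Octic.C4C2Nonsquare.Γ) N → Alg (M + N) → Alg N → Alg M)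
    (hpair : ∀ Φ, IsCMType (Elt.conj Octic.C4C2Nonsquare.Γ) Φ → Alg {Φ, Elt.conj Octic.C4C2Nonsquare.Γ • Φ})
    (htwist : ∀ M g, Alg M → Alg (twistMul M g))
    (hreps : ∀ r ∈ Octic.C4C2Nonsquare.reps, Alg (cornersMul Octic.C4C2Nonsquare.Γ r))
    (M : Multiset (Finset (Elt Octic.C4C2Nonsquare.Γ))) (hM : IsZeroSumG (Elt.conj Octic.C4C2Nonsquare.Γ) M) : Alg M :=
  alg_of_reps Octic.C4C2Nonsquare.Γ Octic.C4C2Nonsquare.reps coversFaces_octicC4C2Nonsquare Alg hadd hcancel hpair htwist hreps M hM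

/-- **Row `Octic.Triquadratic`** (degree 8, triquadratic; 6): S4 on the sealed representatives' corner products ⟹ S4 for every corner product. -/
theorem alg_of_reps_octicTriquadratic (Alg : Multiset (Finset (Elt Octic.Triquadratic.Γ)) → Prop)
    (hadd : ∀ M N, IsZeroSumG (Elt.conj Octic.Triquadratic.Γ) M → IsZeroSumG (Elt.conj Octic.Triquadratic.Γ) N → Alg M → Alg N → Alg (M + N))
    (hcancel : ∀ M N, IsZeroSumG (Elt.conj Octic.Triquadratic.Γ) M → IsZeroSumG (Elt.conj Octic.Triquadratic.Γ) N → Alg (M + N) → Alg N → Alg M)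
    (hpair : ∀ Φ, IsCMType (Elt.conj Octic.Triquadratic.Γ) Φ → Alg {Φ, Elt.conj Octic.Triquadratic.Γ • Φ})
    (htwist : ∀ M g, Alg M → Alg (twistMul M g))
    (hreps : ∀ r ∈ Octic.Triquadratic.reps, Alg (cornersMul Octic.Triquadratic.Γ r))
    (M : Multiset (Finset (Elt Octic.Triquadratic.Γ))) (hM : IsZeroSumG (Elt.conj Octic.Triquadratic.Γ) M) : Alg M :=
  alg_of_reps Octic.Triquadratic.Γ Octic.Triquadratic.reps coversFaces_octicTriquadratic Alg hadd hcancel hpair htwist hreps M hM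

/-- **Row `Octic.Dihedral`** (degree 8, dihedral; 5): S4 on the sealed representatives' corner products ⟹ S4 for every corner product. -/
theorem alg_of_reps_octicDihedral (Alg : Multiset (Finset (Elt Octic.Dihedral.Γ)) → Prop)
    (hadd : ∀ M N, IsZeroSumG (Elt.conj Octic.Dihedral.Γ) M → IsZeroSumG (Elt.conj Octic.Dihedral.Γ) N → Alg M → Alg N → Alg (M + N))
    (hcancel : ∀ M N, IsZeroSumG (Elt.conj Octic.Dihedral.Γ) M → IsZeroSumG (Elt.conj Octic.Dihedral.Γ) N → Alg (M + N) → Alg N → Alg M)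
    (hpair : ∀ Φ, IsCMType (Elt.conj Octic.Dihedral.Γ) Φ → Alg {Φ, Elt.conj Octic.Dihedral.Γ • Φ})
    (htwist : ∀ M g, Alg M → Alg (twistMul M g))
    (hreps : ∀ r ∈ Octic.Dihedral.reps, Alg (cornersMul Octic.Dihedral.Γ r))
    (M : Multiset (Finset (Elt Octic.Dihedral.Γ))) (hM : IsZeroSumG (Elt.conj Octic.Dihedral.Γ) M) : Alg M :=
  alg_of_reps Octic.Dihedral.Γ Octic.Dihedral.reps coversFaces_octicDihedral Alg hadd hcancel hpair htwist hreps M hM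

/-- **Row `Octic.Quaternion`** (degree 8, quaternion; 3): S4 on the sealed representatives' corner products ⟹ S4 for every corner product. -/
theorem alg_of_reps_octicQuaternion (Alg : Multiset (Finset (Elt Octic.Quaternion.Γ)) → Prop)
    (hadd : ∀ M N, IsZeroSumG (Elt.conj Octic.Quaternion.Γ) M → IsZeroSumG (Elt.conj Octic.Quaternion.Γ) N → Alg M → Alg N → Alg (M + N))
    (hcancel : ∀ M N, IsZeroSumG (Elt.conj Octic.Quaternion.Γ) M → IsZeroSumG (Elt.conj Octic.Quaternion.Γ) N → Alg (M + N) → Alg N → Alg M)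
    (hpair : ∀ Φ, IsCMType (Elt.conj Octic.Quaternion.Γ) Φ → Alg {Φ, Elt.conj Octic.Quaternion.Γ • Φ})
    (htwist : ∀ M g, Alg M → Alg (twistMul M g))
    (hreps : ∀ r ∈ Octic.Quaternion.reps, Alg (cornersMul Octic.Quaternion.Γ r))
    (M : Multiset (Finset (Elt Octic.Quaternion.Γ))) (hM : IsZeroSumG (Elt.conj Octic.Quaternion.Γ) M) : Alg M :=
  alg_of_reps Octic.Quaternion.Γ Octic.Quaternion.reps coversFaces_octicQuaternion Alg hadd hcancel hpair htwist hreps M hM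

/-- **Row `Duodecic.Cyclic`** (degree 12, cyclic; 20): S4 on the sealed representatives' corner products ⟹ S4 for every corner product. -/
theorem alg_of_reps_duodecicCyclic (Alg : Multiset (Finset (Elt Duodecic.Cyclic.Γ)) → Prop)
    (hadd : ∀ M N, IsZeroSumG (Elt.conj Duodecic.Cyclic.Γ) M → IsZeroSumG (Elt.conj Duodecic.Cyclic.Γ) N → Alg M → Alg N → Alg (M + N))
    (hcancel : ∀ M N, IsZeroSumG (Elt.conj Duodecic.Cyclic.Γ) M → IsZeroSumG (Elt.conj Duodecic.Cyclic.Γ) N → Alg (M + N) → Alg N → Alg M)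
    (hpair : ∀ Φ, IsCMType (Elt.conj Duodecic.Cyclic.Γ) Φ → Alg {Φ, Elt.conj Duodecic.Cyclic.Γ • Φ})
    (htwist : ∀ M g, Alg M → Alg (twistMul M g))
    (hreps : ∀ r ∈ Duodecic.Cyclic.reps, Alg (cornersMul Duodecic.Cyclic.Γ r))
    (M : Multiset (Finset (Elt Duodecic.Cyclic.Γ))) (hM : IsZeroSumG (Elt.conj Duodecic.Cyclic.Γ) M) : Alg M :=
  alg_of_reps Duodecic.Cyclic.Γ Duodecic.Cyclic.reps coversFaces_duodecicCyclic Alg hadd hcancel hpair htwist hreps M hM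

/-- **Row `Duodecic.C6C2`** (degree 12, `ℤ/6 × ℤ/2`; 22): S4 on the sealed representatives' corner products ⟹ S4 for every corner product. -/
theorem alg_of_reps_duodecicC6C2 (Alg : Multiset (Finset (Elt Duodecic.C6C2.Γ)) → Prop)
    (hadd : ∀ M N, IsZeroSumG (Elt.conj Duodecic.C6C2.Γ) M → IsZeroSumG (Elt.conj Duodecic.C6C2.Γ) N → Alg M → Alg N → Alg (M + N))
    (hcancel : ∀ M N, IsZeroSumG (Elt.conj Duodecic.C6C2.Γ) M → IsZeroSumG (Elt.conj Duodecic.C6C2.Γ) N → Alg (M + N) → Alg N → Alg M)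
    (hpair : ∀ Φ, IsCMType (Elt.conj Duodecic.C6C2.Γ) Φ → Alg {Φ, Elt.conj Duodecic.C6C2.Γ • Φ})
    (htwist : ∀ M g, Alg M → Alg (twistMul M g))
    (hreps : ∀ r ∈ Duodecic.C6C2.reps, Alg (cornersMul Duodecic.C6C2.Γ r))
    (M : Multiset (Finset (Elt Duodecic.C6C2.Γ))) (hM : IsZeroSumG (Elt.conj Duodecic.C6C2.Γ) M) : Alg M :=
  alg_of_reps Duodecic.C6C2.Γ Duodecic.C6C2.reps coversFaces_duodecicC6C2 Alg hadd hcancel hpair htwist hreps M hM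

/-- **Row `Duodecic.Dihedral`** (degree 12, dihedral; 26): S4 on the sealed representatives' corner products ⟹ S4 for every corner product. -/
theorem alg_of_reps_duodecicDihedral (Alg : Multiset (Finset (Elt Duodecic.Dihedral.Γ)) → Prop)
    (hadd : ∀ M N, IsZeroSumG (Elt.conj Duodecic.Dihedral.Γ) M → IsZeroSumG (Elt.conj Duodecic.Dihedral.Γ) N → Alg M → Alg N → Alg (M + N))
    (hcancel : ∀ M N, IsZeroSumG (Elt.conj Duodecic.Dihedral.Γ) M → IsZeroSumG (Elt.conj Duodecic.Dihedral.Γ) N → Alg (M + N) → Alg N → Alg M)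
    (hpair : ∀ Φ, IsCMType (Elt.conj Duodecic.Dihedral.Γ) Φ → Alg {Φ, Elt.conj Duodecic.Dihedral.Γ • Φ})
    (htwist : ∀ M g, Alg M → Alg (twistMul M g))
    (hreps : ∀ r ∈ Duodecic.Dihedral.reps, Alg (cornersMul Duodecic.Dihedral.Γ r))
    (M : Multiset (Finset (Elt Duodecic.Dihedral.Γ))) (hM : IsZeroSumG (Elt.conj Duodecic.Dihedral.Γ) M) : Alg M :=
  alg_of_reps Duodecic.Dihedral.Γ Duodecic.Dihedral.reps coversFaces_duodecicDihedral Alg hadd hcancel hpair htwist hreps M hM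

/-- **Row `Duodecic.Dicyclic`** (degree 12, dicyclic; 20): S4 on the sealed representatives' corner products ⟹ S4 for every corner product. -/
theorem alg_of_reps_duodecicDicyclic (Alg : Multiset (Finset (Elt Duodecic.Dicyclic.Γ)) → Prop)
    (hadd : ∀ M N, IsZeroSumG (Elt.conj Duodecic.Dicyclic.Γ) M → IsZeroSumG (Elt.conj Duodecic.Dicyclic.Γ) N → Alg M → Alg N → Alg (M + N))
    (hcancel : ∀ M N, IsZeroSumG (Elt.conj Duodecic.Dicyclic.Γ) M → IsZeroSumG (Elt.conj Duodecic.Dicyclic.Γ) N → Alg (M + N) → Alg N → Alg M)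
    (hpair : ∀ Φ, IsCMType (Elt.conj Duodecic.Dicyclic.Γ) Φ → Alg {Φ, Elt.conj Duodecic.Dicyclic.Γ • Φ})
    (htwist : ∀ M g, Alg M → Alg (twistMul M g))
    (hreps : ∀ r ∈ Duodecic.Dicyclic.reps, Alg (cornersMul Duodecic.Dicyclic.Γ r))
    (M : Multiset (Finset (Elt Duodecic.Dicyclic.Γ))) (hM : IsZeroSumG (Elt.conj Duodecic.Dicyclic.Γ) M) : Alg M :=
  alg_of_reps Duodecic.Dicyclic.Γ Duodecic.Dicyclic.reps coversFaces_duodecicDicyclic Alg hadd hcancel hpair htwist hreps M hM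

/-- **Degree 6, explicitly**: the cyclic sextic row has ONE sealed representative, the face `(7; 9, 18)` (the CM type
`{σ⁰, σ¹, σ²}` flipped at the places `{σ⁰, σ³}` and `{σ¹, σ⁴}`); `Alg` on its corner product (+ hpair / Lemma P /
htwist) gives `Alg` on every zero-sum multiset — the route's «degree 6» instance as a one-face hypothesis. -/
theorem alg_of_sexticFace (Alg : Multiset (Finset (Elt Sextic.Cyclic.Γ)) → Prop)
    (hadd : ∀ M N, IsZeroSumG (Elt.conj Sextic.Cyclic.Γ) M → IsZeroSumG (Elt.conj Sextic.Cyclic.Γ) N →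
      Alg M → Alg N → Alg (M + N))
    (hcancel : ∀ M N, IsZeroSumG (Elt.conj Sextic.Cyclic.Γ) M → IsZeroSumG (Elt.conj Sextic.Cyclic.Γ) N →
      Alg (M + N) → Alg N → Alg M)
    (hpair : ∀ Φ, IsCMType (Elt.conj Sextic.Cyclic.Γ) Φ → Alg {Φ, Elt.conj Sextic.Cyclic.Γ • Φ})
    (htwist : ∀ M g, Alg M → Alg (twistMul M g))
    (hface : Alg (cornersMul Sextic.Cyclic.Γ (7, 9, 18)))
    (M : Multiset (Finset (Elt Sextic.Cyclic.Γ))) (hM : IsZeroSumG (Elt.conj Sextic.Cyclic.Γ) M) : Alg M :=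
  alg_of_reps_sexticCyclic Alg hadd hcancel hpair htwist
    (fun r hr => by
      have : r = (7, 9, 18) := by simpa [Sextic.Cyclic.reps] using hr
      rw [this]; exact hface) M hM

end HodgeRepro.Night3.Census
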